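import Summits.ABC.StewartYu.GenThreeInductionArchW
import HarnessLib

/-!
# Cell abc-stewartyu, WP-L.A shell (parcel P-A1): the BASE RANKS `n = 0, 1` of the pivot-weighted dichotomy
# (Nesterenko 2003, Cor. 2.4 in Matveev's currency) and the crux text from the weighted dichotomy at ranks `≥ 2`

`Summits/ABC/StewartYu/GenThreeBaseArchW.lean` — cell `abc-stewartyu` (HOME `run/shared/lean/pub/abc-stewartyu/`),
route `YuMatveevShapeRat` (rung A1.L, crux r2 `ArchCoreRat`, stmt-ABC-20502), seat p4 (g9), parcel WP-L.A P-A1; the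
pivot-weighted twin of `GenThreeBaseArch.lean`.  Theorems only.

At rank `1` the pivot-weighted hypothesis `|b₀|·A₀ ≤ B·A₀` is the unweighted `|b₀| ≤ B`, so rank one is
`GenThreeBaseArch.coreArch_one` (Liouville + `|eᶻ − 1| ≤ 2|z|`, for `2 ≤ C 1`); rank `0` is vacuous (no pivot in
`Fin 0`).  `archCoreRat_of_dichotomyW_two_le`: the crux text `ArchCoreRat` from a monotone admissible `C ≤ c₁ⁿ`
with `2 ≤ C 1` and the weighted dichotomy `DichotomyArchW C n` at every rank `n ≥ 2` — the target the
archimedean frame (lp-1 `ArchLvInv`, p5 `ArchG3*`, p1 `ArchG3Par`) now discharges; `…_pow` is the `C r := cʳ`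
instance (`2 ≤ c`).

WHAT THIS IS NOT: no analytic frame; no crux moves.

References: Yu. V. Nesterenko, LNM 1819 (2003), Cor. 2.4 (p. 56), Thm 2.2 (p. 55); E. M. Matveev, Izv. Math. 64
(2000), (1.3).
-/

noncomputable section

open Finset

namespace Summit.ABC.StewartYu.GenThreeBaseArchW

open Summit.ABC.StewartYu.GenThreeInductionArch
open Summit.ABC.StewartYu.GenThreeInductionArchW
open Summit.ABC.StewartYu.GenThreeBaseArch (coreArch_one)

/-! ### The base ranks -/

/-- Rank `0` of the pivot-weighted internal statement is vacuous (there is no pivot in `Fin 0`). [folklore] -/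
theorem coreArchW_zero (C : ℕ → ℝ) : CoreArchW C 0 :=
  fun _ _ _ _ k₀ => Fin.elim0 k₀

/-- Rank `0` of the pivot-weighted dichotomy is vacuous. [folklore] -/
theorem dichotomyArchW_zero (C : ℕ → ℝ) : DichotomyArchW C 0 :=
  fun _ _ _ _ k₀ => Fin.elim0 k₀

/-- **Cor. 2.4 in Matveev's currency — rank `1`**, for `2 ≤ C 1`: at rank one the weighted hypothesis is
`|b₀| ≤ B`, and `GenThreeBaseArch.coreArch_one` applies. [cite: Nesterenko2003, Cor 2.4 (p. 56)] -/
theorem coreArchW_one {C : ℕ → ℝ} (hC : 2 ≤ C 1) : CoreArchW C 1 := by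
  intro a b A B k₀ ha hind hA hA1 hk₀ hBw
  have hb : b ≠ 0 := fun h0 => hk₀ (by rw [h0]; rfl)
  have hB : ∀ i, (|b i| : ℝ) ≤ B := by
    intro i
    have hi : i = k₀ := Subsingleton.elim _ _
    subst hi
    exact abs_pivot_le_boundW hA1 hBw
  exact coreArch_one hC a b A B ha hind hA hA1 hb hB

/-- **Cor. 2.4 — rank `1` of the pivot-weighted dichotomy** (first branch), for `2 ≤ C 1`.
[cite: Nesterenko2003, Cor 2.4 (p. 56)] -/
theorem dichotomyArchW_one {C : ℕ → ℝ} (hC : 2 ≤ C 1) : DichotomyArchW C 1 :=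
  fun a b A B k₀ ha hind hA hA1 hk₀ hBw => Or.inl (coreArchW_one hC a b A B k₀ ha hind hA hA1 hk₀ hBw)

/-! ### The crux text from the weighted dichotomy at ranks `≥ 2` -/

/-- The weighted dichotomy at EVERY rank from the weighted dichotomy at ranks `≥ 2` and `2 ≤ C 1`. [folklore] -/
theorem dichotomyArchW_all {C : ℕ → ℝ} (hC1 : 2 ≤ C 1) (hD : ∀ n, 2 ≤ n → DichotomyArchW C n) :
    ∀ n, DichotomyArchW C n := by
  intro n
  rcases Nat.lt_or_ge n 2 with hn | hn
  · interval_cases n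
    · exact dichotomyArchW_zero C
    · exact dichotomyArchW_one hC1
  · exact hD n hn

/-- **The crux text `ArchCoreRat` from a monotone admissible `C ≤ c₁ⁿ` with `2 ≤ C 1` and the pivot-weighted
archimedean dichotomy at every rank `n ≥ 2`** (ranks `0, 1` by `dichotomyArchW_zero/one`; induction
`core_of_dichotomyW`; transfer `archCoreRat_of_coreW`).
[cite: Nesterenko2003, Thm 2.2 from Cor 2.4 and Prop 2.6 (pp. 55–58); Matveev2000, (1.3); shape only] -/
theorem archCoreRat_of_dichotomyW_two_le {C : ℕ → ℝ} {c₁ : ℝ} (hC : ∀ m, 0 ≤ C m ∧ C m ≤ c₁ ^ m)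
    (hCmono : Monotone C) (hC1 : 2 ≤ C 1) (hD : ∀ n, 2 ≤ n → DichotomyArchW C n) :
    ∃ c : ℝ, ∀ (r : ℕ) (a : Fin r → ℚ) (b : Fin r → ℤ) (A : Fin r → ℝ) (B : ℝ),
      (∀ i, 0 < a i) →
      (∀ μ : Fin r → ℤ, ∏ i, a i ^ μ i = 1 → μ = 0) →
      (∀ i, Height.logHeight₁ (a i) ≤ A i) → (∀ i, 1 ≤ A i) →
      b ≠ 0 → (∀ i, (|b i| : ℝ) ≤ B) →
      -(c ^ r * (∏ i, A i) * Real.log (Real.exp 1 * B)) ≤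
        Real.log |∑ i, (b i : ℝ) * Real.log (a i : ℝ)| :=
  archCoreRat_of_coreW hC hCmono (core_of_dichotomyW (dichotomyArchW_all hC1 hD))

/-- **The same with `C r := cʳ`, `2 ≤ c`** — the form in which the line of crux r2 is registered: the archimedean
frame owes `∀ n ≥ 2, DichotomyArchW (fun r => c ^ r) n` for ONE real `c ≥ 2`.
[cite: Nesterenko2003, Thm 2.2 (p. 55); shape only] -/
theorem archCoreRat_of_dichotomyW_two_le_pow {c : ℝ} (hc : 2 ≤ c)
    (hD : ∀ n, 2 ≤ n → DichotomyArchW (fun r => c ^ r) n) :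
    ∃ c : ℝ, ∀ (r : ℕ) (a : Fin r → ℚ) (b : Fin r → ℤ) (A : Fin r → ℝ) (B : ℝ),
      (∀ i, 0 < a i) →
      (∀ μ : Fin r → ℤ, ∏ i, a i ^ μ i = 1 → μ = 0) →
      (∀ i, Height.logHeight₁ (a i) ≤ A i) → (∀ i, 1 ≤ A i) →
      b ≠ 0 → (∀ i, (|b i| : ℝ) ≤ B) →
      -(c ^ r * (∏ i, A i) * Real.log (Real.exp 1 * B)) ≤
        Real.log |∑ i, (b i : ℝ) * Real.log (a i : ℝ)| := by
  have hc1 : 1 ≤ c := by linarith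
  exact archCoreRat_of_dichotomyW_two_le (c₁ := c) (fun m => ⟨by positivity, le_rfl⟩)
    (fun r s hrs => pow_le_pow_right₀ hc1 hrs) (by simpa using hc) hD

/-- **The pivot-weighted internal statement at EVERY rank from the weighted dichotomy at ranks `≥ 2`** (for seats
that want `CoreArchW` itself, e.g. as an induction hypothesis inside the frame). [cite: Matveev2000, Thm 2.1; shape only] -/
theorem coreArchW_of_dichotomyW_two_le {C : ℕ → ℝ} (hC1 : 2 ≤ C 1) (hD : ∀ n, 2 ≤ n → DichotomyArchW C n) :
    ∀ r, CoreArchW C r :=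
  core_of_dichotomyW (dichotomyArchW_all hC1 hD)

end Summit.ABC.StewartYu.GenThreeBaseArchW

end
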